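import Literature.Geometry.Riemannian.SurgicalRicciFlowBallAbsorption
import Literature.Topology.FourManifolds.NeckCapping
import HarnessLib

/-!
# Cutting a neck piece of a surgery step: the surgery data pass to the capped sides

Part of the deduction of Hamilton's Cor. 1.2(a)
(`Literature.Geometry.Riemannian.hamilton_chen_tang_zhu`) from Chen–Zhu's Thm. 1.1
(`Literature.Geometry.Riemannian.chenZhu_ricciFlowWithSurgery`). In the setting of
`SurgicalRicciFlowBallAbsorption.lean` (closed `N ⊆ X`, a diffeomorphism `Φ : U → U'` onto an open
subset of the next manifold `M'` with `Φ '' N = N' ∩ U'`, the components of `X ∖ N` being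
finitely many collared necks `S³ × (0,1)` and balls, those of `M' ∖ N'` collared balls, and
every boundary sphere of an `M'`-piece inside `U'` or disjoint from it), let `C₀` be a neck
piece and `ψ : S³ × ℝ ↪ X` a neck presenting it (`ψ (S³ × (-½, ½)) = C₀`, `ψ (θ, s) ∈ N` for
`|s| ≥ ½`; both the collar `ι₀ (θ, s + ½)` of `C₀` and its flip qualify), with a side `D`
(`Literature.Topology.FourManifolds.NeckCapData`, `NeckCapping.lean`). We prove that the **capped
side** `D.Capped` (Hamilton's "cutting the neck and rounding off the end") carries data of the
same kind: `N₁ = inl (N ∩ D.side)`, the pieces of `D.Capped ∖ N₁` are the pieces of `X ∖ N`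
inside the side (transported along the open smooth embedding `inl`) together with **one new
collared ball**, the cap `inr (B(0, ½))`, and `Φ₁ = Φ ∘ inl⁻¹`; the number of non-ball pieces
drops by one (`exists_transport_neckCapData`). This is the inductive step of the inner induction
(on the number of necks) in `SurgicalRicciFlowBridge.lean`.

## References

* R. S. Hamilton, *Four-manifolds with positive isotropic curvature*, Comm. Anal. Geom. 5 (1997),
  §1.1 pp. 3–4 ("we replace `S³ × B¹` with two copies of the ball `B⁴` by cutting the neck and
  rounding off the ends"). [Hamilton1997]
* B.-L. Chen, X.-P. Zhu, *Ricci flow with surgery on four-manifolds with positive isotropic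
  curvature*, J. Differential Geom. 74 (2006), Thm. 1.1 (iii), §5 p. 25. [ChenZhu2006]
-/

noncomputable section

open Set Function Metric TopologicalSpace Filter
open scoped Manifold ContDiff Topology

namespace Literature.Geometry.Riemannian

open Literature.Topology.FourManifolds

/-! ### Components from a partition into open connected sets -/

section Partition

variable {M : Type*} [TopologicalSpace M]

/-- **A partition of `U` into pairwise disjoint, open, connected sets is the set of its
components.** [folklore] -/
theorem componentsOf_eq_of_partition {U : Set M} {F : Set (Set M)}
    (hopen : ∀ C ∈ F, IsOpen C) (hconn : ∀ C ∈ F, IsConnected C)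
    (hdisj : ∀ C ∈ F, ∀ C' ∈ F, C ≠ C' → Disjoint C C') (hU : ⋃₀ F = U) :
    componentsOf U = F := by
  -- the component of a point of `C ∈ F` is `C`
  have key : ∀ C ∈ F, ∀ x ∈ C, connectedComponentIn U x = C := by
    intro C hC x hx
    have hCU : C ⊆ U := hU ▸ subset_sUnion_of_mem hC
    apply Subset.antisymm
    · -- the component is preconnected and lies in `C ∪ ⋃ (F ∖ {C})`
      have hV : IsOpen (⋃₀ (F \ {C})) := isOpen_sUnion fun C' hC' => hopen C' hC'.1
      have hsub : connectedComponentIn U x ⊆ C ∪ ⋃₀ (F \ {C}) := by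
        intro y hy
        have hyU : y ∈ U := connectedComponentIn_subset U x hy
        rw [← hU] at hyU
        obtain ⟨C', hC', hyC'⟩ := hyU
        by_cases h : C' = C
        · exact Or.inl (h ▸ hyC')
        · exact Or.inr ⟨C', ⟨hC', h⟩, hyC'⟩
      have hdisj' : Disjoint C (⋃₀ (F \ {C})) := by
        rw [disjoint_sUnion_right]
        intro C' hC'
        exact hdisj C hC C' hC'.1 (Ne.symm hC'.2)
      exact isPreconnected_connectedComponentIn.subset_left_of_subset_union (hopen C hC) hV
        hdisj' hsub ⟨x, mem_connectedComponentIn (hCU hx), hx⟩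
    · exact (hconn C hC).isPreconnected.subset_connectedComponentIn hx hCU
  ext D
  rw [mem_componentsOf_iff]
  constructor
  · rintro ⟨x, hx, rfl⟩
    rw [← hU] at hx
    obtain ⟨C, hC, hxC⟩ := hx
    rw [key C hC x hxC]
    exact hC
  · intro hD
    obtain ⟨x, hx⟩ := (hconn D hD).nonempty
    exact ⟨x, hU ▸ ⟨D, hD, hx⟩, key D hD x hx⟩

end Partition

/-! ### Sides of a neck: connected sets off the middle sphere -/

section Side

variable {X : Type} [TopologicalSpace X] [ChartedSpace (EuclideanSpace ℝ (Fin 4)) X]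
  [Fact (Module.finrank ℝ (EuclideanSpace ℝ (Fin 4)) = 3 + 1)]
  {ψ : Metric.sphere (0 : EuclideanSpace ℝ (Fin 4)) 1 × ℝ → X}

/-- **A preconnected set off the middle sphere which meets a side lies in it** (the side and
the far side `(A ∪ ψ (S³ × {0}))ᶜ` are disjoint open sets covering the complement of the middle
sphere). [folklore] -/
theorem subset_side_of_isPreconnected (D : NeckCapData 3 ψ) {s : Set X}
    (hs : IsPreconnected s) (hmid : Disjoint s (ψ '' (univ ×ˢ {0})))
    (hmeet : (s ∩ (D.side : Set X)).Nonempty) : s ⊆ (D.side : Set X) := by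
  have hfar : IsOpen ((D.side : Set X) ∪ ψ '' (univ ×ˢ {0}))ᶜ := D.isClosed_side_union.isOpen_compl
  refine hs.subset_left_of_subset_union D.side.2 hfar ?_ (fun x hx => ?_) hmeet
  · exact disjoint_left.2 fun x hx hx' => hx' (Or.inl hx)
  · by_cases h : x ∈ (D.side : Set X)
    · exact Or.inl h
    · exact Or.inr fun h' => h'.elim h fun hm => hmid.le_bot ⟨hx, hm⟩

/-- A connected range off the middle sphere containing a point of the side lies in the side.
[folklore] -/
theorem range_subset_side (D : NeckCapData 3 ψ) {α : Type*} [TopologicalSpace α]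
    [PreconnectedSpace α] {g : α → X} (hg : Continuous g)
    (hmid : Disjoint (range g) (ψ '' (univ ×ˢ {0}))) {a : α} (ha : g a ∈ (D.side : Set X)) :
    ∀ q, g q ∈ (D.side : Set X) := fun q =>
  subset_side_of_isPreconnected D (isPreconnected_range hg) hmid ⟨g a, mem_range_self a, ha⟩
    (mem_range_self q)

end Side

/-! ### Transporting pieces into the capped side -/

section Transport

variable {X : Type} [TopologicalSpace X] [ChartedSpace (EuclideanSpace ℝ (Fin 4)) X]
  [IsManifold (𝓡 4) ∞ X] [Fact (Module.finrank ℝ (EuclideanSpace ℝ (Fin 4)) = 3 + 1)]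
  {ψ : Metric.sphere (0 : EuclideanSpace ℝ (Fin 4)) 1 × ℝ → X}

omit [IsManifold (𝓡 4) ∞ X] in
/-- Points of the side, as a subset `{a | a.val ∈ S}` of the subtype, pushed into the capped
side: membership. [folklore] -/
theorem mem_image_inl_preimage_iff (D : NeckCapData 3 ψ) {S : Set X} {a : D.side} :
    D.glueData.inl a ∈ D.glueData.inl '' (Subtype.val ⁻¹' S) ↔ (a : X) ∈ S := by
  rw [D.glueData.inl_injective.mem_set_image, mem_preimage]

/-- **A neck piece inside the side is a neck piece of the capped side** (relative to
`N₁ = inl (N ∩ A)`): its collar `ι : S³ × ℝ ↪ X` has connected range off the middle sphere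
(`range ι ⊆ C ∪ N`), hence inside the side, and `inl ∘ ι` is again a collar
(`NeckCapData.isSmoothEmbedding_inl_comp`). [folklore] -/
theorem IsNeckPiece.transport (D : NeckCapData 3 ψ) {N C : Set X} (h : IsNeckPiece N C)
    (hmidN : Disjoint (ψ '' (univ ×ˢ {0})) N)
    (hmidC : Disjoint (ψ '' (univ ×ˢ {0})) C) (hCside : (C ∩ (D.side : Set X)).Nonempty) :
    IsNeckPiece (D.glueData.inl '' (Subtype.val ⁻¹' N)) (D.glueData.inl '' (Subtype.val ⁻¹' C)) ∧
      C ⊆ (D.side : Set X) := by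
  obtain ⟨ι, hι, ho, hιC, hιN⟩ := h
  haveI : Fact (Module.finrank ℝ (EuclideanSpace ℝ (Fin 4)) = 3 + 1) := inferInstance
  -- `range ι ⊆ C ∪ N` misses the middle sphere
  have hrange : range ι ⊆ C ∪ N := by
    rintro _ ⟨q, rfl⟩
    by_cases hq : q ∈ (univ : Set (Metric.sphere (0 : EuclideanSpace ℝ (Fin 4)) 1)) ×ˢ Ioo (0 : ℝ) 1
    · exact Or.inl (hιC ▸ mem_image_of_mem ι hq)
    · exact Or.inr (hιN (mem_image_of_mem ι ⟨mem_univ _, fun h => hq ⟨mem_univ _, h⟩⟩))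
  have hmid : Disjoint (range ι) (ψ '' (univ ×ˢ {0})) := disjoint_left.2 fun x hx hm =>
    (hrange hx).elim (fun hC => hmidC.le_bot ⟨hm, hC⟩) fun hN => hmidN.le_bot ⟨hm, hN⟩
  obtain ⟨x₀, hx₀C, hx₀s⟩ := hCside
  obtain ⟨q₀, hq₀, rfl⟩ := (hιC.symm ▸ hx₀C : x₀ ∈ ι '' (univ ×ˢ Ioo 0 1))
  haveI : PreconnectedSpace (Metric.sphere (0 : EuclideanSpace ℝ (Fin 4)) 1 × ℝ) := by
    have h1 : 1 < Module.rank ℝ (EuclideanSpace ℝ (Fin 4)) := by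
      rw [← Module.finrank_eq_rank, finrank_euclideanSpace_fin]; norm_num
    haveI := isPreconnected_iff_preconnectedSpace.1
      (isConnected_sphere h1 (0 : EuclideanSpace ℝ (Fin 4)) zero_le_one).isPreconnected
    infer_instance
  have hside : ∀ q, ι q ∈ (D.side : Set X) :=
    range_subset_side D hι.contMDiff.continuous hmid hx₀s
  have hCside : C ⊆ (D.side : Set X) := by
    rw [← hιC]; rintro _ ⟨q, -, rfl⟩; exact hside q
  refine ⟨⟨fun q => D.glueData.inl ⟨ι q, hside q⟩, D.isSmoothEmbedding_inl_comp hι hside,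
    D.isOpen_range_inl_comp ho hside, ?_, ?_⟩, hCside⟩
  · apply Subset.antisymm
    · rintro _ ⟨q, hq, rfl⟩
      exact ⟨⟨ι q, hside q⟩, show ι q ∈ C from hιC ▸ mem_image_of_mem ι hq, rfl⟩
    · rintro _ ⟨a, ha, rfl⟩
      obtain ⟨q, hq, hqa⟩ := (hιC.symm ▸ ha : (a : X) ∈ ι '' (univ ×ˢ Ioo 0 1))
      exact ⟨q, hq, by simp only; congr 1; exact Subtype.ext hqa⟩
  · rintro _ ⟨q, hq, rfl⟩
    exact ⟨⟨ι q, hside q⟩, show ι q ∈ N from hιN (mem_image_of_mem ι hq), rfl⟩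

/-- **A ball piece inside the side is a ball piece of the capped side.** [folklore] -/
theorem IsBallPiece.transport (D : NeckCapData 3 ψ) {N C : Set X} (h : IsBallPiece N C)
    (hmidN : Disjoint (ψ '' (univ ×ˢ {0})) N)
    (hmidC : Disjoint (ψ '' (univ ×ˢ {0})) C) (hCside : (C ∩ (D.side : Set X)).Nonempty) :
    IsBallPiece (D.glueData.inl '' (Subtype.val ⁻¹' N)) (D.glueData.inl '' (Subtype.val ⁻¹' C)) ∧
      C ⊆ (D.side : Set X) := by
  obtain ⟨ι, hι, ho, hιC, hιN⟩ := h
  have hrange : range ι ⊆ C ∪ N := by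
    rintro _ ⟨x, rfl⟩
    by_cases hx : x ∈ ball (0 : EuclideanSpace ℝ (Fin 4)) 1
    · exact Or.inl (hιC ▸ mem_image_of_mem ι hx)
    · exact Or.inr (hιN (mem_image_of_mem ι hx))
  have hmid : Disjoint (range ι) (ψ '' (univ ×ˢ {0})) := disjoint_left.2 fun x hx hm =>
    (hrange hx).elim (fun hC => hmidC.le_bot ⟨hm, hC⟩) fun hN => hmidN.le_bot ⟨hm, hN⟩
  obtain ⟨x₀, hx₀C, hx₀s⟩ := hCside
  obtain ⟨q₀, hq₀, rfl⟩ := (hιC.symm ▸ hx₀C : x₀ ∈ ι '' ball 0 1)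
  have hside : ∀ q, ι q ∈ (D.side : Set X) :=
    range_subset_side D hι.contMDiff.continuous hmid hx₀s
  have hCside : C ⊆ (D.side : Set X) := by
    rw [← hιC]; rintro _ ⟨q, -, rfl⟩; exact hside q
  refine ⟨⟨fun q => D.glueData.inl ⟨ι q, hside q⟩, D.isSmoothEmbedding_inl_comp hι hside,
    D.isOpen_range_inl_comp ho hside, ?_, ?_⟩, hCside⟩
  · apply Subset.antisymm
    · rintro _ ⟨q, hq, rfl⟩
      exact ⟨⟨ι q, hside q⟩, show ι q ∈ C from hιC ▸ mem_image_of_mem ι hq, rfl⟩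
    · rintro _ ⟨a, ha, rfl⟩
      obtain ⟨q, hq, hqa⟩ := (hιC.symm ▸ ha : (a : X) ∈ ι '' ball 0 1)
      exact ⟨q, hq, by simp only; congr 1; exact Subtype.ext hqa⟩
  · rintro _ ⟨q, hq, rfl⟩
    exact ⟨⟨ι q, hside q⟩, show ι q ∈ N from hιN (mem_image_of_mem ι hq), rfl⟩

/-- **The cap is a new collared ball piece**: for a neck `ψ` with `ψ (θ, s) ∈ N` whenever
`s ≥ ½`, the open half-disc `inr (B(0, ½))` of the capped side is a ball piece relative to
`N₁ = inl (N ∩ A)`, with collar `x ↦ inr (x / 2)`. [folklore] -/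
theorem isBallPiece_inr_ball (D : NeckCapData 3 ψ) {N : Set X}
    (hψN : ∀ (θ : Metric.sphere (0 : EuclideanSpace ℝ (Fin 4)) 1) (s : ℝ), 1 / 2 ≤ s → ψ (θ, s) ∈ N) :
    IsBallPiece (D.glueData.inl '' (Subtype.val ⁻¹' N))
      (D.glueData.inr '' ball (0 : EuclideanSpace ℝ (Fin 4)) (1 / 2)) := by
  set σ : EuclideanSpace ℝ (Fin 4) ≃L[ℝ] EuclideanSpace ℝ (Fin 4) :=
    ContinuousLinearEquiv.smulLeft (Units.mk0 (1 / 2 : ℝ) (by norm_num)) with hσ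
  have hσa : ∀ x, σ x = (1 / 2 : ℝ) • x := fun x => rfl
  have hemb : Manifold.IsSmoothEmbedding (𝓡 4) (𝓡 4) ∞ (fun x => D.glueData.inr (σ x)) :=
    D.glueData.isSmoothEmbedding_inr.comp_diffeomorph σ.toDiffeomorph
  have himage : ∀ r : ℝ, 0 < r → (σ : EuclideanSpace ℝ (Fin 4) → EuclideanSpace ℝ (Fin 4)) '' ball 0 r =
      ball 0 (r / 2) := by
    intro r hr
    apply Subset.antisymm
    · rintro _ ⟨x, hx, rfl⟩
      rw [mem_ball_zero_iff] at hx ⊢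
      rw [hσa, norm_smul, Real.norm_eq_abs, abs_of_pos (by norm_num : (0 : ℝ) < 1 / 2)]
      linarith
    · intro y hy
      refine ⟨(2 : ℝ) • y, ?_, ?_⟩
      · rw [mem_ball_zero_iff] at hy ⊢
        rw [norm_smul, Real.norm_eq_abs, abs_of_pos (by norm_num : (0 : ℝ) < 2)]
        linarith
      · rw [hσa, smul_smul]; norm_num
  refine ⟨fun x => D.glueData.inr (σ x), hemb, ?_, ?_, ?_⟩
  · have : range (fun x => D.glueData.inr (σ x)) = range D.glueData.inr := by
      show range (D.glueData.inr ∘ σ) = _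
      rw [Set.range_comp]
      have : range (σ : EuclideanSpace ℝ (Fin 4) → EuclideanSpace ℝ (Fin 4)) = univ :=
        σ.surjective.range_eq
      rw [this, image_univ]
    rw [this]
    exact D.glueData.isOpen_range_inr
  · show (D.glueData.inr ∘ σ) '' ball 0 1 = _
    rw [image_comp, himage 1 one_pos]
  · rintro _ ⟨x, hx, rfl⟩
    rw [mem_compl_iff, mem_ball_zero_iff, not_lt] at hx
    -- `inr (x/2) = inl (ψ (θ, ‖x‖/2))` with `‖x‖ / 2 ≥ 1/2`
    have hx0 : x ≠ 0 := by rintro rfl; rw [norm_zero] at hx; linarith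
    set t : ℝ := ‖σ x‖ with ht
    have htpos : 0 < t := norm_pos_iff.2 (by rw [hσa]; exact smul_ne_zero (by norm_num) hx0)
    have htval : t = ‖x‖ / 2 := by
      rw [ht, hσa, norm_smul, Real.norm_eq_abs, abs_of_pos (by norm_num : (0 : ℝ) < 1 / 2)]; ring
    set θ : Metric.sphere (0 : EuclideanSpace ℝ (Fin 4)) 1 :=
      ⟨t⁻¹ • σ x, by rw [mem_sphere_zero_iff_norm, norm_smul, norm_inv, Real.norm_eq_abs,
        abs_of_pos htpos, inv_mul_cancel₀ htpos.ne']⟩ with hθ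
    have hxθ : σ x = t • (θ : EuclideanSpace ℝ (Fin 4)) := by
      simp only [hθ, smul_smul, mul_inv_cancel₀ htpos.ne', one_smul]
    refine ⟨⟨ψ (θ, t), D.mem_side θ htpos⟩, ?_, ?_⟩
    · show ψ (θ, t) ∈ N
      exact hψN θ t (by rw [htval]; linarith)
    · rw [D.inl_eq_inr θ htpos, ← hxθ]

end Transport


/-! ### The surgery data on the capped side -/

section Main

variable {X : Type} [TopologicalSpace X] [ChartedSpace (EuclideanSpace ℝ (Fin 4)) X]
  [IsManifold (𝓡 4) ∞ X] [Fact (Module.finrank ℝ (EuclideanSpace ℝ (Fin 4)) = 3 + 1)]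
  {ψ : Metric.sphere (0 : EuclideanSpace ℝ (Fin 4)) 1 × ℝ → X}
  {M' : Type} [TopologicalSpace M'] [T2Space M'] [ChartedSpace (EuclideanSpace ℝ (Fin 4)) M']

/-- **Cutting a neck: the surgery data pass to the capped side, with one neck fewer.** Setting
of the module docstring. Given the data `(N, U, U', Φ, Ψ)` on `X` relative to `(M', N')`, a
non-ball piece `C₀` of `X ∖ N` presented by the neck `ψ` (`ψ (S³ × (-½, ½)) = C₀`, and
`ψ (θ, s) ∈ N` for `|s| ≥ ½`), and a side `D` of `ψ`, the capped side `D.Capped` carries data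
`(N₁, U₁, U₁', Φ₁, Ψ₁)` of the same kind: `N₁ = inl (N ∩ A)`, `U₁ = inl (U ∩ A)`,
`U₁' = Φ (U ∩ A)`, `Φ₁ = Φ ∘ inl⁻¹`; the pieces of `D.Capped ∖ N₁` are the pieces of `X ∖ N`
inside the side `A`, pushed forward by `inl` (`IsNeckPiece.transport`, `IsBallPiece.transport`),
and the cap `inr (B(0, ½))`, a collared ball (`NeckCapData.isBallPiece_inr_ball`); so the pieces
are again necks and balls, finitely many, with at least one non-ball piece (`C₀`) fewer; and a
boundary sphere of an `M'`-piece inside `U'` lies in `Φ (N)`, is connected, hence lies in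
`Φ (N ∩ A) ⊆ U₁'` or in `Φ (N ∖ A)`, which is disjoint from `U₁'`. This is the book-keeping
behind Hamilton's "cutting the neck and rounding off the ends" (1997, p. 3) for one end.
[cite: Hamilton1997, §1.1 pp. 3–4] [cite: ChenZhu2006, Thm. 1.1 (iii) (p. 3)] -/
theorem exists_transport_neckCapData
    {N : Set X} {N' : Set M'} {U : Set X} {U' : Set M'} {Φ : X → M'} {Ψ : M' → X}
    (hN : IsClosed N) (hN' : IsClosed N') (hU : IsOpen U) (hNU : N ⊆ U) (hU' : IsOpen U')
    (hΦc : ContMDiffOn (𝓡 4) (𝓡 4) ∞ Φ U) (hΨc : ContMDiffOn (𝓡 4) (𝓡 4) ∞ Ψ U')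
    (hΦ : MapsTo Φ U U') (hΨ : MapsTo Ψ U' U)
    (hleft : ∀ x ∈ U, Ψ (Φ x) = x) (hright : ∀ y ∈ U', Φ (Ψ y) = y) (hΦN : Φ '' N = N' ∩ U')
    (hfin : (componentsOf Nᶜ).Finite)
    (hpieces : ∀ C ∈ componentsOf Nᶜ, IsNeckPiece N C ∨ IsBallPiece N C)
    (hM : ∀ C' ∈ componentsOf N'ᶜ, IsBallPiece N' C')
    (hfr : ∀ C' ∈ componentsOf N'ᶜ, frontier C' ⊆ U' ∨ Disjoint (frontier C') U')
    {C₀ : Set X} (hC₀ : C₀ ∈ componentsOf Nᶜ) (hC₀b : ¬ IsBallPiece N C₀)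
    (D : NeckCapData 3 ψ)
    (hψC₀ : ψ '' (univ ×ˢ Ioo (-(1 / 2)) (1 / 2)) = C₀)
    (hψN : ∀ (θ : Metric.sphere (0 : EuclideanSpace ℝ (Fin 4)) 1) (s : ℝ), 1 / 2 ≤ |s| →
      ψ (θ, s) ∈ N) :
    ∃ (N₁ U₁ : Set D.Capped) (U₁' : Set M') (Φ₁ : D.Capped → M') (Ψ₁ : M' → D.Capped),
      IsClosed N₁ ∧ IsOpen U₁ ∧ N₁ ⊆ U₁ ∧ IsOpen U₁' ∧
      ContMDiffOn (𝓡 4) (𝓡 4) ∞ Φ₁ U₁ ∧ ContMDiffOn (𝓡 4) (𝓡 4) ∞ Ψ₁ U₁' ∧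
      MapsTo Φ₁ U₁ U₁' ∧ MapsTo Ψ₁ U₁' U₁ ∧
      (∀ x ∈ U₁, Ψ₁ (Φ₁ x) = x) ∧ (∀ y ∈ U₁', Φ₁ (Ψ₁ y) = y) ∧ Φ₁ '' N₁ = N' ∩ U₁' ∧
      (componentsOf N₁ᶜ).Finite ∧
      (∀ C₁ ∈ componentsOf N₁ᶜ, IsNeckPiece N₁ C₁ ∨ IsBallPiece N₁ C₁) ∧
      {C₁ ∈ componentsOf N₁ᶜ | ¬ IsBallPiece N₁ C₁}.ncard + 1 ≤
        {C ∈ componentsOf Nᶜ | ¬ IsBallPiece N C}.ncard ∧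
      ∀ C' ∈ componentsOf N'ᶜ, frontier C' ⊆ U₁' ∨ Disjoint (frontier C') U₁' := by
  classical
  haveI : LocallyConnectedSpace X :=
    ChartedSpace.locallyConnectedSpace (EuclideanSpace ℝ (Fin 4)) X
  haveI : LocallyConnectedSpace M' :=
    ChartedSpace.locallyConnectedSpace (EuclideanSpace ℝ (Fin 4)) M'
  haveI : Nonempty D.side := D.nonempty_side
  -- notation
  set A : Set X := (D.side : Set X) with hAdef
  set mid : Set X := ψ '' (univ ×ˢ {0}) with hmid_def
  set inl := D.glueData.inl with hinl_def
  set inr := D.glueData.inr with hinr_def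
  have hinl_inj : Injective inl := D.glueData.inl_injective
  have hinr_inj : Injective inr := D.glueData.inr_injective
  have hrange_inl : range inl = {inr 0}ᶜ := D.range_inl
  have hinl_inr : ∀ (θ : Metric.sphere (0 : EuclideanSpace ℝ (Fin 4)) 1) {t : ℝ} (ht : 0 < t),
      inl ⟨ψ (θ, t), D.mem_side θ ht⟩ = inr (t • (θ : EuclideanSpace ℝ (Fin 4))) :=
    fun θ t ht => D.inl_eq_inr θ ht
  -- polar decomposition of a nonzero vector
  have hpolar : ∀ x : EuclideanSpace ℝ (Fin 4), x ≠ 0 →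
      ∃ (θ : Metric.sphere (0 : EuclideanSpace ℝ (Fin 4)) 1), x = ‖x‖ • (θ : EuclideanSpace ℝ (Fin 4)) := by
    intro x hx
    have hn : 0 < ‖x‖ := norm_pos_iff.2 hx
    refine ⟨⟨‖x‖⁻¹ • x, by rw [mem_sphere_zero_iff_norm, norm_smul, norm_inv, norm_norm,
      inv_mul_cancel₀ hn.ne']⟩, ?_⟩
    simp only [smul_smul, mul_inv_cancel₀ hn.ne', one_smul]
  -- basic facts on `C₀`, the middle sphere and the side
  have hC₀N : Disjoint C₀ N := disjoint_of_mem_componentsOf_compl hC₀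
  have hmidC₀ : mid ⊆ C₀ := by
    rw [← hψC₀]
    rintro _ ⟨⟨θ, t⟩, ⟨-, ht⟩, rfl⟩
    rw [mem_singleton_iff] at ht
    subst ht
    exact mem_image_of_mem ψ ⟨mem_univ _, by norm_num, by norm_num⟩
  have hmidN : Disjoint mid N := disjoint_left.2 fun x hx hxN => hC₀N.le_bot ⟨hmidC₀ hx, hxN⟩
  have hmidC : ∀ C ∈ componentsOf Nᶜ, C ≠ C₀ → Disjoint mid C := fun C hC hne =>
    disjoint_left.2 fun x hx hxC => hne (eq_of_mem_componentsOf_of_mem hC hC₀ hxC (hmidC₀ hx))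
  have hmem_C₀ : ∀ {p : X}, p ∈ C₀ ↔ ∃ (θ : Metric.sphere (0 : EuclideanSpace ℝ (Fin 4)) 1) (s : ℝ),
      -(1 / 2) < s ∧ s < 1 / 2 ∧ ψ (θ, s) = p := by
    intro p
    rw [← hψC₀]
    constructor
    · rintro ⟨⟨θ, s⟩, ⟨-, hs⟩, rfl⟩
      exact ⟨θ, s, hs.1, hs.2, rfl⟩
    · rintro ⟨θ, s, h1, h2, rfl⟩
      exact ⟨(θ, s), ⟨mem_univ _, h1, h2⟩, rfl⟩
  have hN_A_or_far : ∀ z ∈ N, z ∈ A ∨ z ∈ (A ∪ mid)ᶜ := fun z hz => by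
    by_cases h : z ∈ A
    · exact Or.inl h
    · exact Or.inr fun h' => h'.elim h fun hm => hmidN.le_bot ⟨hm, hz⟩
  -- the new sets
  set N₁ : Set D.Capped := inl '' (Subtype.val ⁻¹' N) with hN₁def
  set U₁ : Set D.Capped := inl '' (Subtype.val ⁻¹' U) with hU₁def
  set U₁' : Set M' := Φ '' (U ∩ A) with hU₁'def
  have hmemN₁ : ∀ {a : D.side}, inl a ∈ N₁ ↔ (a : X) ∈ N := fun {a} =>
    mem_image_inl_preimage_iff D
  have hmemU₁ : ∀ {a : D.side}, inl a ∈ U₁ ↔ (a : X) ∈ U := fun {a} =>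
    mem_image_inl_preimage_iff D
  have hinr_notMem_N₁ : ∀ {x : EuclideanSpace ℝ (Fin 4)}, ‖x‖ < 1 / 2 → inr x ∉ N₁ := by
    intro x hx hmem
    obtain ⟨a, ha, hax⟩ := hmem
    by_cases hx0 : x = 0
    · have : inl a ∈ range inl := mem_range_self a
      rw [hrange_inl, hax, hx0] at this
      exact this rfl
    · obtain ⟨θ, hxθ⟩ := hpolar x hx0
      have hpos : 0 < ‖x‖ := norm_pos_iff.2 hx0
      have h1 : inl a = inl ⟨ψ (θ, ‖x‖), D.mem_side θ hpos⟩ := by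
        rw [hax, hinl_inr θ hpos, ← hxθ]
      have h2 : (a : X) = ψ (θ, ‖x‖) := congrArg Subtype.val (hinl_inj h1)
      have h3 : (a : X) ∈ C₀ := hmem_C₀.2 ⟨θ, ‖x‖, by linarith, hx, h2.symm⟩
      exact hC₀N.le_bot ⟨h3, ha⟩
  have hinr_mem_N₁ : ∀ {x : EuclideanSpace ℝ (Fin 4)}, 1 / 2 ≤ ‖x‖ → inr x ∈ N₁ := by
    intro x hx
    have hx0 : x ≠ 0 := by rintro rfl; rw [norm_zero] at hx; linarith
    obtain ⟨θ, hxθ⟩ := hpolar x hx0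
    have hpos : 0 < ‖x‖ := norm_pos_iff.2 hx0
    rw [hxθ, ← hinl_inr θ hpos]
    exact hmemN₁.2 (hψN θ ‖x‖ (by rwa [abs_of_pos hpos]))
  -- the family of new pieces
  set T : Set X → Set D.Capped := fun C => inl '' (Subtype.val ⁻¹' C) with hTdef
  set B : Set D.Capped := inr '' ball 0 (1 / 2) with hBdef
  set F : Set (Set D.Capped) :=
    T '' {C ∈ componentsOf Nᶜ | C ≠ C₀ ∧ (C ∩ A).Nonempty} ∪ {B} with hFdef
  -- (a) the members of `F` are open
  have hTopen : ∀ C ∈ componentsOf Nᶜ, IsOpen (T C) := fun C hC =>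
    D.glueData.isOpenMap_inl _ ((isOpen_of_mem_componentsOf hN.isOpen_compl hC).preimage
      continuous_subtype_val)
  have hBopen : IsOpen B := D.glueData.isOpenMap_inr _ isOpen_ball
  -- (b) connected
  have hTconn : ∀ C ∈ componentsOf Nᶜ, C ⊆ A → IsConnected (T C) := by
    intro C hC hCA
    have hC' := isConnected_of_mem_componentsOf hC
    haveI := isConnected_iff_connectedSpace.1 hC'
    have : T C = range (fun x : C => inl ⟨(x : X), hCA x.2⟩) := by
      apply Subset.antisymm
      · rintro _ ⟨a, ha, rfl⟩
        exact ⟨⟨a, ha⟩, rfl⟩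
      · rintro _ ⟨x, rfl⟩
        exact ⟨⟨x, hCA x.2⟩, x.2, rfl⟩
    rw [this]
    exact isConnected_range (D.glueData.continuous_inl.comp
      (Continuous.subtype_mk continuous_subtype_val _))
  have hBconn : IsConnected B :=
    ((convex_ball (0 : EuclideanSpace ℝ (Fin 4)) (1 / 2)).isConnected
      ⟨0, mem_ball_self (by norm_num)⟩).image _ D.glueData.continuous_inr.continuousOn
  -- (c) `T C` for `C ≠ C₀` misses `B`
  have hTB : ∀ C ∈ componentsOf Nᶜ, C ≠ C₀ → Disjoint (T C) B := by
    intro C hC hne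
    refine disjoint_left.2 ?_
    rintro _ ⟨a, ha, rfl⟩ ⟨x, hx, hxa⟩
    rw [mem_ball_zero_iff] at hx
    by_cases hx0 : x = 0
    · have : inl a ∈ range inl := mem_range_self a
      rw [hrange_inl, ← hxa, hx0] at this
      exact this rfl
    · obtain ⟨θ, hxθ⟩ := hpolar x hx0
      have hpos : 0 < ‖x‖ := norm_pos_iff.2 hx0
      have h1 : inl a = inl ⟨ψ (θ, ‖x‖), D.mem_side θ hpos⟩ := by
        rw [← hxa, hinl_inr θ hpos, ← hxθ]
      have h2 : (a : X) = ψ (θ, ‖x‖) := congrArg Subtype.val (hinl_inj h1)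
      have h3 : (a : X) ∈ C₀ := hmem_C₀.2 ⟨θ, ‖x‖, by linarith, hx, h2.symm⟩
      exact hne (eq_of_mem_componentsOf_of_mem hC hC₀ ha h3)
  -- (d) `T C`, `T C'` are disjoint for `C ≠ C'`
  have hTT : ∀ C ∈ componentsOf Nᶜ, ∀ C' ∈ componentsOf Nᶜ, C ≠ C' → Disjoint (T C) (T C') := by
    intro C hC C' hC' hne
    refine disjoint_left.2 ?_
    rintro _ ⟨a, ha, rfl⟩ ⟨a', ha', he⟩
    have : a' = a := hinl_inj he
    subst this
    exact hne (eq_of_mem_componentsOf_of_mem hC hC' ha ha')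
  -- (e) pieces meeting the side lie in it (necks and balls have connected collars)
  have hCsub : ∀ C ∈ componentsOf Nᶜ, C ≠ C₀ → (C ∩ A).Nonempty → C ⊆ A := by
    intro C hC hne hCA
    rcases hpieces C hC with h | h
    · exact (h.transport D hmidN (hmidC C hC hne) hCA).2
    · exact (h.transport D hmidN (hmidC C hC hne) hCA).2
  -- (f) the union of `F` is the complement of `N₁`
  have hcover : ⋃₀ F = N₁ᶜ := by
    apply Subset.antisymm
    · rintro p ⟨C₁, hC₁, hp⟩
      rcases hC₁ with ⟨C, ⟨hC, -, -⟩, rfl⟩ | hC₁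
      · obtain ⟨a, ha, rfl⟩ := hp
        exact fun h => (disjoint_of_mem_componentsOf_compl hC).le_bot ⟨ha, hmemN₁.1 h⟩
      · rw [mem_singleton_iff] at hC₁
        subst hC₁
        obtain ⟨x, hx, rfl⟩ := hp
        exact hinr_notMem_N₁ (mem_ball_zero_iff.1 hx)
    · intro p hp
      rcases D.glueData.exists_inl_or_inr p with ⟨a, rfl⟩ | ⟨x, rfl⟩
      · have haN : (a : X) ∉ N := fun h => hp (hmemN₁.2 h)
        set C := connectedComponentIn Nᶜ (a : X) with hCdef
        have hC : C ∈ componentsOf Nᶜ := connectedComponentIn_mem_componentsOf haN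
        have haC : (a : X) ∈ C := mem_connectedComponentIn haN
        by_cases hne : C = C₀
        · -- `a ∈ C₀ ∩ A = ψ (S³ × (0, ½))`, a point of the cap
          obtain ⟨θ, s, h1, h2, has⟩ := hmem_C₀.1 (hne ▸ haC)
          have hs : 0 < s := (D.mem_side_iff θ s).1 (has.symm ▸ a.2 : ψ (θ, s) ∈ D.side)
          refine ⟨B, Or.inr rfl, ⟨s • (θ : EuclideanSpace ℝ (Fin 4)), ?_, ?_⟩⟩
          · rw [mem_ball_zero_iff, norm_smul, Real.norm_eq_abs, abs_of_pos hs,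
              mem_sphere_zero_iff_norm.1 θ.2, mul_one]
            exact h2
          · change inr _ = inl a
            rw [← hinl_inr θ hs]
            congr 1
            exact Subtype.ext has
        · exact ⟨T C, Or.inl ⟨C, ⟨hC, hne, ⟨a, haC, a.2⟩⟩, rfl⟩, ⟨a, haC, rfl⟩⟩
      · by_cases hx : ‖x‖ < 1 / 2
        · exact ⟨B, Or.inr rfl, ⟨x, mem_ball_zero_iff.2 hx, rfl⟩⟩
        · exact absurd (hinr_mem_N₁ (not_lt.1 hx)) hp
  -- (g) the components of `N₁ᶜ`
  have hcomp : componentsOf N₁ᶜ = F := by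
    refine componentsOf_eq_of_partition ?_ ?_ ?_ hcover
    · rintro C₁ (⟨C, ⟨hC, -, -⟩, rfl⟩ | hC₁)
      · exact hTopen C hC
      · rw [mem_singleton_iff] at hC₁; subst hC₁; exact hBopen
    · rintro C₁ (⟨C, ⟨hC, hne, hCA⟩, rfl⟩ | hC₁)
      · exact hTconn C hC (hCsub C hC hne hCA)
      · rw [mem_singleton_iff] at hC₁; subst hC₁; exact hBconn
    · rintro C₁ (⟨C, ⟨hC, hne, hCA⟩, rfl⟩ | hC₁) C₁' (⟨C', ⟨hC', hne', hCA'⟩, rfl⟩ | hC₁') hneq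
      · exact hTT C hC C' hC' fun h => hneq (h ▸ rfl)
      · rw [mem_singleton_iff] at hC₁'; subst hC₁'; exact hTB C hC hne
      · rw [mem_singleton_iff] at hC₁; subst hC₁; exact (hTB C' hC' hne').symm
      · rw [mem_singleton_iff] at hC₁ hC₁'; subst hC₁; exact absurd hC₁'.symm hneq
  -- the new closed set, its neighbourhood and the maps
  have hN₁closed : IsClosed N₁ := by
    rw [← isOpen_compl_iff, ← hcover]
    refine isOpen_sUnion ?_
    rintro C₁ (⟨C, ⟨hC, -, -⟩, rfl⟩ | hC₁)
    · exact hTopen C hC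
    · rw [mem_singleton_iff] at hC₁; subst hC₁; exact hBopen
  have hU₁open : IsOpen U₁ := D.glueData.isOpenMap_inl _ (hU.preimage continuous_subtype_val)
  have hN₁U₁ : N₁ ⊆ U₁ := by
    rintro _ ⟨a, ha, rfl⟩
    exact ⟨a, hNU ha, rfl⟩
  have hUA : IsOpen (U ∩ A) := hU.inter D.side.2
  have hU₁'open : IsOpen U₁' :=
    isOpen_image_of_inverse hU' hΨc.continuousOn hΦ hΨ hleft hright hUA inter_subset_left
  have hU₁'U' : U₁' ⊆ U' := by rintro _ ⟨z, hz, rfl⟩; exact hΦ hz.1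
  -- `Φ₁ = Φ ∘ inl⁻¹`
  set einl := D.glueData.isOpenEmbedding_inl.toOpenPartialHomeomorph inl with heinl
  have heinl_symm : ∀ a, einl.symm (inl a) = a := fun a =>
    D.glueData.isOpenEmbedding_inl.toOpenPartialHomeomorph_left_inv
  have heinl_c : ContMDiffOn 𝓘(ℝ, EuclideanSpace ℝ (Fin 4)) 𝓘(ℝ, EuclideanSpace ℝ (Fin 4)) ∞
      einl.symm (range inl) :=
    contMDiffOn_symm_of_isSmoothEmbedding D.glueData.isSmoothEmbedding_inl
      D.glueData.isOpenEmbedding_inl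
  set Φ₁ : D.Capped → M' := fun p => Φ ((einl.symm p : D.side) : X) with hΦ₁def
  have hΦ₁inl : ∀ a, Φ₁ (inl a) = Φ (a : X) := fun a => by
    simp only [hΦ₁def, heinl_symm]
  -- `Ψ₁ = inl ∘ Ψ`, corrected off `U₁'`
  obtain ⟨a₀⟩ := (inferInstance : Nonempty D.side)
  set g : M' → D.side := fun y => if h : Ψ y ∈ A then ⟨Ψ y, h⟩ else a₀ with hgdef
  have hg_val : ∀ y ∈ U₁', ((g y : D.side) : X) = Ψ y := by
    rintro _ ⟨z, hz, rfl⟩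
    have : Ψ (Φ z) ∈ A := by rw [hleft z hz.1]; exact hz.2
    simp only [hgdef, dif_pos this]
  have hg_eq : ∀ {z} (hz : z ∈ U ∩ A), g (Φ z) = ⟨z, hz.2⟩ := fun {z} hz => by
    apply Subtype.ext
    rw [hg_val (Φ z) ⟨z, hz, rfl⟩, hleft z hz.1]
  set Ψ₁ : M' → D.Capped := fun y => inl (g y) with hΨ₁def
  -- smoothness
  have hΦ₁c : ContMDiffOn (𝓡 4) (𝓡 4) ∞ Φ₁ U₁ := by
    have h1 : ContMDiffOn 𝓘(ℝ, EuclideanSpace ℝ (Fin 4)) 𝓘(ℝ, EuclideanSpace ℝ (Fin 4)) ∞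
        einl.symm U₁ := heinl_c.mono (image_subset_range _ _)
    have h2 : ContMDiffOn 𝓘(ℝ, EuclideanSpace ℝ (Fin 4)) (𝓡 4) ∞
        (fun p => ((einl.symm p : D.side) : X)) U₁ :=
      contMDiff_subtype_val.comp_contMDiffOn h1
    refine hΦc.comp h2 ?_
    rintro _ ⟨a, ha, rfl⟩
    show ((einl.symm (inl a) : D.side) : X) ∈ U
    rw [heinl_symm]
    exact ha
  have hΨ₁c : ContMDiffOn (𝓡 4) (𝓡 4) ∞ Ψ₁ U₁' := by
    intro y hy
    have hg : ContMDiffWithinAt (𝓡 4) (𝓡 4) ∞ g U₁' y := by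
      rw [← ContMDiffWithinAt.subtypeVal_comp_iff]
      exact (hΨc y (hU₁'U' hy)).mono hU₁'U' |>.congr (fun y' hy' => hg_val y' hy') (hg_val y hy)
    exact D.glueData.contMDiff_inl.contMDiffAt.comp_contMDiffWithinAt y hg
  -- inverse identities and mapping properties
  have hleft₁ : ∀ p ∈ U₁, Ψ₁ (Φ₁ p) = p := by
    rintro _ ⟨a, ha, rfl⟩
    rw [hΦ₁inl]
    show inl (g (Φ (a : X))) = inl a
    rw [hg_eq ⟨ha, a.2⟩]
  have hright₁ : ∀ y ∈ U₁', Φ₁ (Ψ₁ y) = y := by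
    rintro _ ⟨z, hz, rfl⟩
    show Φ₁ (inl (g (Φ z))) = Φ z
    rw [hg_eq hz, hΦ₁inl]
  have hmaps₁ : MapsTo Φ₁ U₁ U₁' := by
    rintro _ ⟨a, ha, rfl⟩
    rw [hΦ₁inl]
    exact ⟨a, ⟨ha, a.2⟩, rfl⟩
  have hmaps₁' : MapsTo Ψ₁ U₁' U₁ := by
    rintro _ ⟨z, hz, rfl⟩
    show inl (g (Φ z)) ∈ U₁
    rw [hg_eq hz]
    exact ⟨⟨z, hz.2⟩, hz.1, rfl⟩
  have hinΦ : ∀ z ∈ U, z ∈ N → Φ z ∈ N' := fun z _ hzN => by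
    have : Φ z ∈ Φ '' N := mem_image_of_mem Φ hzN
    rw [hΦN] at this
    exact this.1
  have himage : Φ₁ '' N₁ = N' ∩ U₁' := by
    apply Subset.antisymm
    · rintro _ ⟨_, ⟨a, ha, rfl⟩, rfl⟩
      rw [hΦ₁inl]
      exact ⟨hinΦ _ (hNU ha) ha, ⟨a, ⟨hNU ha, a.2⟩, rfl⟩⟩
    · rintro y ⟨hyN', ⟨z, hz, rfl⟩⟩
      obtain ⟨z₀, hz₀, he⟩ := (hΦN.symm ▸ ⟨hyN', hΦ hz.1⟩ : Φ z ∈ Φ '' N)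
      have : z₀ = z := by rw [← hleft z₀ (hNU hz₀), he, hleft z hz.1]
      subst this
      exact ⟨inl ⟨z₀, hz.2⟩, ⟨⟨z₀, hz.2⟩, hz₀, rfl⟩, hΦ₁inl _⟩
  -- finiteness and types of the new pieces
  have hψN' : ∀ (θ : Metric.sphere (0 : EuclideanSpace ℝ (Fin 4)) 1) (s : ℝ), 1 / 2 ≤ s →
      ψ (θ, s) ∈ N := fun θ s hs => hψN θ s (by rw [abs_of_pos (by linarith)]; exact hs)
  have hBball : IsBallPiece N₁ B := isBallPiece_inr_ball D hψN'
  have hfin₁ : F.Finite :=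
    ((hfin.subset (sep_subset _ _)).image T).union (finite_singleton B)
  have htypes : ∀ C₁ ∈ F, IsNeckPiece N₁ C₁ ∨ IsBallPiece N₁ C₁ := by
    rintro C₁ (⟨C, ⟨hC, hne, hCA⟩, rfl⟩ | hC₁)
    · rcases hpieces C hC with h | h
      · exact Or.inl (h.transport D hmidN (hmidC C hC hne) hCA).1
      · exact Or.inr (h.transport D hmidN (hmidC C hC hne) hCA).1
    · rw [mem_singleton_iff] at hC₁; subst hC₁; exact Or.inr hBball
  -- the count of non-ball pieces drops
  have hcount : {C₁ ∈ F | ¬ IsBallPiece N₁ C₁}.ncard + 1 ≤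
      {C ∈ componentsOf Nᶜ | ¬ IsBallPiece N C}.ncard := by
    set S : Set (Set X) := {C ∈ componentsOf Nᶜ | ¬ IsBallPiece N C} with hSdef
    have hSfin : S.Finite := hfin.subset (sep_subset _ _)
    have hC₀S : C₀ ∈ S := ⟨hC₀, hC₀b⟩
    have hsub : {C₁ ∈ F | ¬ IsBallPiece N₁ C₁} ⊆ T '' (S \ {C₀}) := by
      rintro C₁ ⟨hC₁F, hC₁b⟩
      rcases hC₁F with ⟨C, ⟨hC, hne, hCA⟩, rfl⟩ | hC₁
      · refine ⟨C, ⟨⟨hC, fun hb => hC₁b ?_⟩, hne⟩, rfl⟩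
        exact (hb.transport D hmidN (hmidC C hC hne) hCA).1
      · rw [mem_singleton_iff] at hC₁; subst hC₁; exact absurd hBball hC₁b
    calc {C₁ ∈ F | ¬ IsBallPiece N₁ C₁}.ncard + 1
        ≤ (T '' (S \ {C₀})).ncard + 1 :=
          Nat.add_le_add_right (ncard_le_ncard hsub (hSfin.sdiff.image T)) 1
      _ ≤ (S \ {C₀}).ncard + 1 := Nat.add_le_add_right (ncard_image_le hSfin.sdiff) 1
      _ = S.ncard := ncard_sdiff_singleton_add_one hC₀S hSfin
  -- boundary spheres of the `M'`-pieces
  have hfr₁ : ∀ C' ∈ componentsOf N'ᶜ, frontier C' ⊆ U₁' ∨ Disjoint (frontier C') U₁' := by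
    intro C' hC'
    rcases hfr C' hC' with h | h
    · -- `frontier C' ⊆ Φ N ⊆ Φ (U ∩ A) ∪ Φ (U ∩ far)`, and it is connected
      obtain ⟨ι', hι', -, hι'C, -⟩ := hM C' hC'
      have hC'o : IsOpen C' := isOpen_of_mem_componentsOf hN'.isOpen_compl hC'
      have hfrE : frontier C' = ι' '' Metric.sphere 0 1 := by
        rw [hC'o.frontier_eq]
        exact IsBallPiece.closure_diff_eq_of_witness hι'.contMDiff.continuous
          hι'.isEmbedding.injective hι'C
      have hpre : IsPreconnected (frontier C') := by
        rw [hfrE]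
        have h1 : 1 < Module.rank ℝ (EuclideanSpace ℝ (Fin 4)) := by
          rw [← Module.finrank_eq_rank, finrank_euclideanSpace_fin]; norm_num
        exact (isConnected_sphere h1 (0 : EuclideanSpace ℝ (Fin 4)) zero_le_one).isPreconnected.image
          _ hι'.contMDiff.continuous.continuousOn
      set far : Set X := (A ∪ mid)ᶜ with hfar
      have hfaro : IsOpen (U ∩ far) := hU.inter D.isClosed_side_union.isOpen_compl
      have hO₂ : IsOpen (Φ '' (U ∩ far)) :=
        isOpen_image_of_inverse hU' hΨc.continuousOn hΦ hΨ hleft hright hfaro inter_subset_left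
      have hdisj : Disjoint U₁' (Φ '' (U ∩ far)) := by
        refine disjoint_left.2 ?_
        rintro _ ⟨z, hz, rfl⟩ ⟨z', hz', he⟩
        have : z' = z := by rw [← hleft z' hz'.1, he, hleft z hz.1]
        subst this
        exact hz'.2 (Or.inl hz.2)
      have hsub : frontier C' ⊆ U₁' ∪ Φ '' (U ∩ far) := by
        intro y hy
        have hyN' : y ∈ N' := by
          rw [hC'o.frontier_eq] at hy
          exact IsBallPiece.closure_diff_subset (hM C' hC')
            (disjoint_of_mem_componentsOf_compl hC') hy
        obtain ⟨z, hz, rfl⟩ := (hΦN.symm ▸ ⟨hyN', h hy⟩ : y ∈ Φ '' N)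
        rcases hN_A_or_far z hz with hzA | hzf
        · exact Or.inl ⟨z, ⟨hNU hz, hzA⟩, rfl⟩
        · exact Or.inr ⟨z, ⟨hNU hz, hzf⟩, rfl⟩
      rcases hpre.subset_or_subset hU₁'open hO₂ hdisj hsub with h' | h'
      · exact Or.inl h'
      · exact Or.inr (disjoint_left.2 fun y hy hy' => hdisj.le_bot ⟨hy', h' hy⟩)
    · exact Or.inr (h.mono_right hU₁'U')
  refine ⟨N₁, U₁, U₁', Φ₁, Ψ₁, hN₁closed, hU₁open, hN₁U₁, hU₁'open, hΦ₁c, hΨ₁c, hmaps₁, hmaps₁',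
    hleft₁, hright₁, himage, hcomp ▸ hfin₁, fun C₁ hC₁ => htypes C₁ (hcomp ▸ hC₁), ?_, hfr₁⟩
  rw [hcomp]
  exact hcount

end Main

end Literature.Geometry.Riemannian
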